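/-
Copyright: lit-balaban Phase-2 proof seat p08 (gen 9).  Statement-level skeleton of a published paper; no proof claims beyond what
the kernel checks below.
-/
import Literature.MathematicalPhysics.QuantumFieldTheory.BalabanImbrieJaffe1984to88.BIJ88CurlyDkLocGradTerm
import Literature.MathematicalPhysics.QuantumFieldTheory.BalabanImbrieJaffe1984to88.BIJ88Decay223CkAllTori

/-!
# `BalabanImbrieJaffe1984to88.BIJ88CurlyDkLocGradTorus` — T. Bałaban, J. Imbrie, A. Jaffe, *Effective action and cluster properties of
the abelian Higgs model*, Commun. Math. Phys. **114** (1988) 257–315 [BalabanImbrieJaffe1988], Sect. 2 p. 261 [PDF 5]: the clause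
**«and similarly for derivatives of 𝒟_{k,loc}»** of (2.13) FOR THE CONCRETE TORUS OBJECT OF RECORD (r18's `dkLocKer`) — PART 2: the
multiscale sum and the assembly, **the `η`-LATTICE DERIVATIVE `η⁻¹Δ_λ𝒟_{k,loc}(b, b″)` OF THE KERNEL DECAYS EXPONENTIALLY, UNIFORMLY IN `k`
AND IN THE RADIUS SCHEDULE**, per torus with NO hypothesis and over all tori with ONE set of constants given [6I] Prop. 1.2 by its tree
name (file 2 of 2; file 1 = `BIJ88CurlyDkLocGradTerm`: the per-scale term).

statement-level skeleton of published theorems with citation tags; proofs where landed; nothing here is a claim about the Yang–Mills mass gap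

PDF held: `paper:balaban1988-cmp114-bij-abelian-higgs-effective-action` (journal page = PDF page + 256), p. 261 [PDF 5] (text layer
re-read this session); [I] = [BalabanImbrieJaffe1985] p. 325 [PDF 27] (7.2.2), p. 326 [PDF 28]; [6I] = [Balaban1984PropagatorsI] Prop. 1.2
(tree name `Balaban1983to89.B5.Prop12Printed`).

CITATION HEADER (lean-in-tree rule).  Part of the lit-balaban TYPED SKELETON (HOME `run/shared/lean/pub/lit-balaban/`), Phase-2 proof
seat p08 (gen 9), unit `lit-balaban-p08`; free-target protocol G.5-34(d), TAKING line HOME/STATUS.md 2026-08-21T21:51:58Z.  WHAT IS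
REPRODUCED = SKELETON row **C2.Eq2.13** (owner r18, referee ref-5), the DERIVATIVE clause, kind «model instance» for r18's (2.12)
`dkLocKer`; companion of p08 g8's `BIJ85CurlyDkGradTorus` (the same for the unlocalized `𝒟_k`).  Decls used BY NAME (nothing restated):
file 1's `abs_gradTermLoc_le`, `exists_cutoffProfile_lipschitz`; this seat's `BIJ88CurlyDkLocDecayTorus.abs_sum_scales_le` (the multiscale
step), `BIJ88Decay223CkAllTori.exists_HB_allTori_of_prop12Printed` (ONE `(δ, M)` for the sup and gradient members of (7.2.2) on every
torus); r18's `dkLocKer`/`termKer`/`kdist`/`dkLocKer_eq_sum`; gen 7's `exists_bound_of_ineq722`/`torusKernelData_gradH`; p09's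
`ineq722_deltaA_of_prop12Printed`, `levStd`; p09 g8's `cloc_decay`; p16's `prop12Printed_levStd_deltaA`.

THE PRINTED TEXT (p. 261 [PDF 5], verbatim): *"Thus |(𝒟_{k,loc}f)(b)| ≦ ce^{−c dist(suppt f,b)}‖f‖_∞ (2.13) and similarly for
derivatives of 𝒟_{k,loc} and Hölder derivatives of order less than 2."*

WHAT IS PROVED (0 `sorry`, standard axioms; theorems only — proof lane; every `d ≥ 2`):
* §1 `dkLocKer_shift_sub_eq_sum` (the `η`-difference of (2.12) is the sum of the `η`-differences of its scale terms) and
  **`abs_dkLocKer_shift_sub_le`**: for `D := dist_k(⟨x,μ⟩, b″) ≥ 2`, radii `ρ_j ≥ ρ₀ > 0` (`j < k`), `a = min(δ, δ_C)/2`: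
  `|𝒟_{k,loc}(⟨x+e_λ,μ⟩, b″) − 𝒟_{k,loc}(⟨x,μ⟩, b″)| ≤ L^{−k}·(1 + 16C_σ/ρ₀)M²M_C·d²e^{a/2}K(a)²·d!/a^d·e^{−(a/2)D}` — the scale-`j` term of file 1
  is `≲ L^{−j}ℓ^{d−2}e^{−aℓD} = L^{−k}ℓ^{d−1}e^{−aℓD}` (`ℓ = L^{k−j}`) and the multiscale step sums it, exactly as for `𝒟_k`.
* §2 **`gradDkLoc_torus_of_ineq722`** (typed (7.2.2) for p09's kernel family + p09 g8's hypothesis-free `cloc_decay` + a slope constant of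
  the cutoff), **`gradDkLoc_torus_prop12`** (given only per-tower `B5.Prop12Printed`), **`gradDkLoc_torus`** (NO HYPOTHESIS, p16's
  `prop12Printed_levStd_deltaA`): `∃ R₀ c₁ δ′, 0 < δ′ ∧ 0 ≤ c₁ ∧ ∀ k ≤ m + K, ∀ ρ with ρ_j ≥ ρ₀ (j < k), ∀ x μ λ b″, R₀ ≤ D →
  L^k·|𝒟_{k,loc}(⟨x+e_λ,μ⟩, b″) − 𝒟_{k,loc}(⟨x,μ⟩, b″)| ≤ c₁e^{−δ′D}` (`L^k = η⁻¹`).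
* §3 **`gradDkLoc_allTori_of_prop12Printed`**: ONE `(R₀, c₁, δ′)` for EVERY torus (`P.d = d`, `P.L = L`), every `k ≤ m + K`, every
  schedule with `ρ_j ≥ ρ₀`, from the all-tori `B5.Prop12Printed` (this seat's `exists_HB_allTori_of_prop12Printed`).
HONEST SCOPE.  (i) Kernel form, forward `η`-difference in the first (output) argument, beyond a threshold (`D ≥ R₀`), as p08 g8 states the
gradient member for `𝒟_k`; the OPERATOR form of the derivative clause (all `b`, `η^d`-weighted, row sums `≲ (L^{k−j})^{−1}`) and the Hölder
clause are not in this file.  (ii) Constants depend on the lower bound `ρ₀` of the radii through `16C_σ/ρ₀` (the cutoff's slope across the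
annulus of width `ρ_j/16`); print has `r(e_k) → ∞`, so `ρ₀ = 1` is harmless there.  (iii) The remaining hypothesis of §2's second theorem is
[6I] Proposition 1.2 BY NAME per tower (typing note G-C1-07; hypothesis-free by p16), of §3 the all-tori form (bridge p19/p30 in flight).
(iv) `U = 1`, real abelian fields, torus, standing range.  (v) No `def`, no new named fact, nothing restated; NOT summit progress.  Unit
`lit-balaban-p08` (literature-prover-lit-balaban-p08-g9-0), 2026-08-21.
-/

open scoped BigOperators RealInnerProductSpace

namespace Literature.MathematicalPhysics.QuantumFieldTheory.BalabanImbrieJaffe1984to88.BIJ88CurlyDkLocGradTorus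

open Balaban1983to89 hiding Site Plaq
open Balaban1983to89.LatticeFieldCalculus
open BIJ88Ineq217Ineq722Torus (exists_bound_of_ineq722 torusKernelData_gradH_nonneg)
open BIJ85Eq721MinimizerKernel (torusKernelData_gradH)
open BIJ85Prop521Torus BIJ85Prop522Torus BIJ85Sigma422Eta
open BIJ85Sect7Statements BIJ85Ineq722Torus
open BIJ85Ineq722DeltaA (deltaAData ineq722_deltaA_of_prop12Printed)
open BIJ85Ineq722ProofPart2 (settingOf)
open BIJ88ClocFactorsTorus (distB distB_apply)
open BIJ88ClocEstimatesTorus (Cloc cloc_decay)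
open BIJ88Cutoffs21 (cutoffProfile)
open BIJ85Prop12PerTower (prop12Printed_levStd_deltaA)
open BIJ88Decay223CkAllTori (exists_HB_allTori_of_prop12Printed)
open BIJ88CurlyDkLocTorus BIJ88CurlyDkLocDecayTorus BIJ88CurlyDkLocGradTerm
-- inside this namespace the bare `Site`/`Plaq` are the `ℤ^d` carriers of the QFT root; the torus ones are renamed:
open Balaban1983to89 renaming Site → TSite, Plaq → TPlaq

noncomputable section

/-! ## §1  The multiscale sum of the `η`-differences -/

section Kernel

variable {P : Params}

/-- `0 < L^n`. [folklore] -/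
private theorem cast_pow_L_pos' (n : ℕ) : (0 : ℝ) < (P.L : ℝ) ^ n := pow_pos P.cast_L_pos n

/-- `L^k = L^j·L^{k−j}` for `j ≤ k`. [folklore] -/
private theorem pow_eq_pow_mul_pow' {j k : ℕ} (hjk : j ≤ k) : (P.L : ℝ) ^ k = (P.L : ℝ) ^ j * (P.L : ℝ) ^ (k - j) := by
  rw [← pow_add, Nat.add_sub_cancel' hjk]

/-- **the `η`-difference of (2.12) through its scale terms**: `𝒟_{k,loc}(⟨x+e_λ,μ⟩, b″) − 𝒟_{k,loc}(⟨x,μ⟩, b″) = Σ_{j<k}(G^{(j),η}_{loc}(⟨x+e_λ,μ⟩, b″)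
− G^{(j),η}_{loc}(⟨x,μ⟩, b″))` (r18's `dkLocKer_eq_sum`; any weights). [cite: BalabanImbrieJaffe1988, (2.12) p.261] -/
theorem dkLocKer_shift_sub_eq_sum (w c : ℝ) (ρ : ℕ → ℝ) (k : ℕ) (x : TSite P 0) (μ lam : Fin P.d) (b'' : PBond P 0) :
    dkLocKer (P := P) w c ρ k ⟨x.shift lam, μ⟩ b'' - dkLocKer (P := P) w c ρ k ⟨x, μ⟩ b'' =
      ∑ j ∈ Finset.range k, (termKer (P := P) w c ρ j ⟨x.shift lam, μ⟩ b'' - termKer (P := P) w c ρ j ⟨x, μ⟩ b'') := by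
  rw [dkLocKer_eq_sum, dkLocKer_eq_sum, ← Finset.sum_sub_distrib]

/-- **EXPONENTIAL DECAY OF THE `η`-DERIVATIVE OF `𝒟_{k,loc}(·, b″)` ON THE TORI, explicit constants, every `d ≥ 2`**: for
`D := dist_k(⟨x,μ⟩, b″) ≥ 2`, radii `ρ_j ≥ ρ₀ > 0` (`j < k`) and `a = min(δ, δ_C)/2`,
`|𝒟_{k,loc}(⟨x+e_λ,μ⟩, b″) − 𝒟_{k,loc}(⟨x,μ⟩, b″)| ≤ L^{−k}·(1 + 16C_σ/ρ₀)M²M_C·d²e^{a/2}K(a)²·d!/a^d·e^{−(a/2)D}` — i.e. the `η`-lattice derivative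
(`η⁻¹ = L^k`) is bounded by `c₁e^{−(a/2)D}` UNIFORMLY IN `k` and in the schedule — GIVEN the sup and gradient members of (7.2.2) for every
`H_j`, the (2.5)-analogue for the `C^{(j)}_{loc}` of record and a slope constant `C_σ` of the cutoff profile: file 1's scale term
`≲ L^{−k}ℓ^{d−1}e^{−aℓD}` summed by `abs_sum_scales_le`. [cite: BalabanImbrieJaffe1988, (2.13) p.261] -/
theorem abs_dkLocKer_shift_sub_le (hd : 2 ≤ P.d) {k : ℕ} (hk : k ≤ P.m + P.K) {a : ℝ} (ha : 0 < a) {δ M δC MC : ℝ} (hδ : 0 < δ)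
    (hδC : 0 < δC) (hMC : 0 ≤ MC)
    (hH : ∀ (j : ℕ) (hj : j ≤ P.m + P.K), j < k → ∀ (μ ν : Fin P.d) (x : TSite P 0) (y : TSite P j),
      |(torusRep P j (deltaAData hj a)).H (x, μ) (y, ν)| ≤ M * Real.exp (-(δ * distEU P j x y)))
    (hB : ∀ (j : ℕ) (hj : j ≤ P.m + P.K), j < k → ∀ (μ ν : Fin P.d) (x : TSite P 0) (y : TSite P j),
      ‖fun lam : Fin P.d => (P.L : ℝ) ^ j *
          ((torusRep P j (deltaAData hj a)).H (x.shift lam, μ) (y, ν) - (torusRep P j (deltaAData hj a)).H (x, μ) (y, ν))‖ ≤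
        M * Real.exp (-(δ * distEU P j x y)))
    {C : ℝ} (hC0 : 0 ≤ C) (hCζ : ∀ (R₁ R₀ : ℝ), R₁ < R₀ → ∀ t s : ℝ,
      |cutoffProfile R₁ R₀ t - cutoffProfile R₁ R₀ s| ≤ C / (R₀ - R₁) * |t - s|)
    (ρ : ℕ → ℝ) {ρ₀ : ℝ} (hρ₀ : 0 < ρ₀) (hρ : ∀ j < k, ρ₀ ≤ ρ j)
    (hCl : ∀ j < k, ∀ b₁ b₂ : PBond P j, |Cloc P j (ρ j / 4) b₁ b₂| ≤ MC * Real.exp (-(δC * (supDist b₁.src b₂.src : ℝ))))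
    {x : TSite P 0} {μ : Fin P.d} (lam : Fin P.d) {b'' : PBond P 0} (hD : 2 ≤ kdist (P := P) k ⟨x, μ⟩ b'') :
    |dkLocKer (P := P) ((P.eta k) ^ P.d) ((P.L : ℝ) ^ k) ρ k ⟨x.shift lam, μ⟩ b'' -
        dkLocKer (P := P) ((P.eta k) ^ P.d) ((P.L : ℝ) ^ k) ρ k ⟨x, μ⟩ b''| ≤
      ((P.L : ℝ) ^ k)⁻¹ * ((1 + 16 * C / ρ₀) * (M ^ 2 * MC * ((P.d : ℝ) ^ 2 *
          (Real.exp (min δ δC / 2 / 2) * ((2 * (1 + P.d / (min δ δC / 2))) ^ P.d) ^ 2))) *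
        (((P.d - 1 + 1).factorial : ℝ) / (min δ δC / 2) ^ (P.d - 1 + 1))) *
        Real.exp (-(min δ δC / 2 / 2 * kdist (P := P) k ⟨x, μ⟩ b'')) := by
  have ha₀ : 0 < min δ δC / 2 := half_pos (lt_min hδ hδC)
  have hLk : 0 < (P.L : ℝ) ^ k := cast_pow_L_pos' k
  rw [dkLocKer_shift_sub_eq_sum]
  have h := abs_sum_scales_le (P := P) (k := k)
    (T := fun j => termKer (P := P) ((P.eta k) ^ P.d) ((P.L : ℝ) ^ k) ρ j ⟨x.shift lam, μ⟩ b'' -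
      termKer (P := P) ((P.eta k) ^ P.d) ((P.L : ℝ) ^ k) ρ j ⟨x, μ⟩ b'')
    (A := ((P.L : ℝ) ^ k)⁻¹ * ((1 + 16 * C / ρ₀) * (M ^ 2 * MC * ((P.d : ℝ) ^ 2 *
      (Real.exp (min δ δC / 2 / 2) * ((2 * (1 + P.d / (min δ δC / 2))) ^ P.d) ^ 2)))))
    (a := min δ δC / 2) (D := kdist (P := P) k ⟨x, μ⟩ b'') (by positivity) ha₀ hD (P.d - 1) fun j hjk => ?_
  · refine h.trans (le_of_eq ?_)
    ring
  have hj : j ≤ P.m + P.K := by omega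
  have hLj := cast_pow_L_pos' (P := P) j
  have hLkj := cast_pow_L_pos' (P := P) (k - j)
  have hρj : 0 < ρ j := lt_of_lt_of_le hρ₀ (hρ j hjk)
  have e1 : (supDist x b''.src : ℝ) / (P.L : ℝ) ^ j = (P.L : ℝ) ^ (k - j) * kdist (P := P) k ⟨x, μ⟩ b'' := by
    unfold kdist
    show (supDist x b''.src : ℝ) / (P.L : ℝ) ^ j = (P.L : ℝ) ^ (k - j) * ((supDist x b''.src : ℝ) / (P.L : ℝ) ^ k)
    rw [pow_eq_pow_mul_pow' (P := P) hjk.le]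
    field_simp
  have hfac : 1 + 16 * C / ρ j ≤ 1 + 16 * C / ρ₀ := by
    have := div_le_div_of_nonneg_left (by positivity : 0 ≤ 16 * C) hρ₀ (hρ j hjk)
    linarith
  have hpow : ((P.L : ℝ) ^ j)⁻¹ * ((P.L : ℝ) ^ (k - j)) ^ (P.d - 2) = ((P.L : ℝ) ^ k)⁻¹ * ((P.L : ℝ) ^ (k - j)) ^ (P.d - 1) := by
    have hq : P.d - 1 = P.d - 2 + 1 := by omega
    rw [hq, pow_succ, pow_eq_pow_mul_pow' (P := P) hjk.le, mul_inv]
    field_simp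
  refine (abs_gradTermLoc_le hd hj hjk.le ha hδ hδC hMC (hH j hj hjk) (hB j hj hjk) hC0 hCζ ρ hρj (hCl j hjk) x μ lam b'').trans ?_
  rw [e1]
  calc ((P.L : ℝ) ^ j)⁻¹ * (1 + 16 * C / ρ j) * (M ^ 2 * (MC * ((P.L : ℝ) ^ (k - j)) ^ (P.d - 2)) * (P.d : ℝ) ^ 2 *
        (Real.exp (min δ δC / 2 / 2) * ((2 * (1 + P.d / (min δ δC / 2))) ^ P.d) ^ 2) *
        Real.exp (-(min δ δC / 2 * ((P.L : ℝ) ^ (k - j) * kdist (P := P) k ⟨x, μ⟩ b''))))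
      = (1 + 16 * C / ρ j) * ((((P.L : ℝ) ^ j)⁻¹ * ((P.L : ℝ) ^ (k - j)) ^ (P.d - 2)) * (M ^ 2 * MC * (P.d : ℝ) ^ 2 *
        (Real.exp (min δ δC / 2 / 2) * ((2 * (1 + P.d / (min δ δC / 2))) ^ P.d) ^ 2) *
        Real.exp (-(min δ δC / 2 * ((P.L : ℝ) ^ (k - j) * kdist (P := P) k ⟨x, μ⟩ b''))))) := by ring
    _ ≤ (1 + 16 * C / ρ₀) * ((((P.L : ℝ) ^ j)⁻¹ * ((P.L : ℝ) ^ (k - j)) ^ (P.d - 2)) * (M ^ 2 * MC * (P.d : ℝ) ^ 2 *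
        (Real.exp (min δ δC / 2 / 2) * ((2 * (1 + P.d / (min δ δC / 2))) ^ P.d) ^ 2) *
        Real.exp (-(min δ δC / 2 * ((P.L : ℝ) ^ (k - j) * kdist (P := P) k ⟨x, μ⟩ b''))))) :=
        mul_le_mul_of_nonneg_right hfac (by positivity)
    _ = _ := by rw [hpow]; ring

end Kernel

/-! ## §2  Assembly per torus -/

section PerTower

variable {P : Params}

/-- **THE DERIVATIVE CLAUSE OF (2.13) ON A TORUS FROM THE TYPED (7.2.2)**, constants UNIFORM IN `k` AND IN THE RADIUS SCHEDULES WITH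
`ρ_j ≥ ρ₀`: given r15's `KernelData.Ineq722` for p09's kernel family (scales covering the standing range) — the `C^{(j)}_{loc}` input being
p09 g8's hypothesis-free `cloc_decay`, the cutoff slope file 1's `exists_cutoffProfile_lipschitz` —
`∃ R₀ c₁ δ′, 0 < δ′ ∧ 0 ≤ c₁ ∧ ∀ k ≤ m + K, ∀ ρ (ρ_j ≥ ρ₀ for j < k), ∀ x μ λ b″, R₀ ≤ dist_k(⟨x,μ⟩,b″) →
L^k·|𝒟_{k,loc}(⟨x+e_λ,μ⟩,b″) − 𝒟_{k,loc}(⟨x,μ⟩,b″)| ≤ c₁e^{−δ′dist_k(⟨x,μ⟩,b″)}`. [cite: BalabanImbrieJaffe1988, (2.13) p.261] -/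
theorem gradDkLoc_torus_of_ineq722 (hd : 2 ≤ P.d) {lev : ℕ → ℕ} (hlev : ∀ i, lev i ≤ P.m + P.K)
    (hcov : ∀ j ≤ P.m + P.K, ∃ i, lev i = j) {a : ℝ} {BondU : ℕ → Type}
    {distEB : (i : ℕ) → TSite P 0 → BondU i → ℝ} {Cker : (i : ℕ) → Fin P.d → Fin P.d → TSite P (lev i) → TSite P (lev i) → ℝ}
    {Dker : (i : ℕ) → TSite P 0 → BondU i → ℝ}
    (h722 : KernelData.Ineq722
      (fun i => torusKernelData P (lev i) (deltaAData (hlev i) a) (BondU i) (distEB i) (Cker i) (Dker i))) (ha : 0 < a)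
    {ρ₀ : ℝ} (hρ₀ : 0 < ρ₀) :
    ∃ R₀ c₁ δ' : ℝ, 0 < δ' ∧ 0 ≤ c₁ ∧ ∀ (k : ℕ) (_ : k ≤ P.m + P.K) (ρ : ℕ → ℝ) (_ : ∀ j < k, ρ₀ ≤ ρ j)
      (x : TSite P 0) (μ lam : Fin P.d) (b'' : PBond P 0), R₀ ≤ kdist (P := P) k ⟨x, μ⟩ b'' →
        (P.L : ℝ) ^ k * |dkLocKer (P := P) ((P.eta k) ^ P.d) ((P.L : ℝ) ^ k) ρ k ⟨x.shift lam, μ⟩ b'' -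
            dkLocKer (P := P) ((P.eta k) ^ P.d) ((P.L : ℝ) ^ k) ρ k ⟨x, μ⟩ b''| ≤
          c₁ * Real.exp (-δ' * kdist (P := P) k ⟨x, μ⟩ b'') := by
  obtain ⟨δ, M, hδ, -, hBall⟩ := exists_bound_of_ineq722 hlev h722
  obtain ⟨MC, δC, hMC, hδC, HC⟩ := cloc_decay P.d P.L hd
  obtain ⟨C, hC0, hCζ⟩ := exists_cutoffProfile_lipschitz
  refine ⟨2, (1 + 16 * C / ρ₀) * (M ^ 2 * MC * ((P.d : ℝ) ^ 2 *
      (Real.exp (min δ δC / 2 / 2) * ((2 * (1 + P.d / (min δ δC / 2))) ^ P.d) ^ 2))) *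
      (((P.d - 1 + 1).factorial : ℝ) / (min δ δC / 2) ^ (P.d - 1 + 1)),
    min δ δC / 2 / 2, by positivity, by positivity, fun k hk ρ hρ x μ lam b'' hfar => ?_⟩
  have hH : ∀ (j : ℕ) (hj : j ≤ P.m + P.K), j < k → ∀ (μ ν : Fin P.d) (x : TSite P 0) (y : TSite P j),
      |(torusRep P j (deltaAData hj a)).H (x, μ) (y, ν)| ≤ M * Real.exp (-(δ * distEU P j x y)) := by
    intro j hj _ μ ν x y
    obtain ⟨i, hi⟩ := hcov j hj
    subst hi
    exact (le_add_of_nonneg_right torusKernelData_gradH_nonneg).trans (hBall i μ ν x y)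
  have hB : ∀ (j : ℕ) (hj : j ≤ P.m + P.K), j < k → ∀ (μ ν : Fin P.d) (x : TSite P 0) (y : TSite P j),
      ‖fun lam : Fin P.d => (P.L : ℝ) ^ j *
          ((torusRep P j (deltaAData hj a)).H (x.shift lam, μ) (y, ν) - (torusRep P j (deltaAData hj a)).H (x, μ) (y, ν))‖ ≤
        M * Real.exp (-(δ * distEU P j x y)) := by
    intro j hj _ μ ν x y
    obtain ⟨i, hi⟩ := hcov j hj
    subst hi
    have h := hBall i μ ν x y
    rw [torusKernelData_gradH] at h
    exact (le_add_of_nonneg_left (abs_nonneg _)).trans h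
  have hCl : ∀ j < k, ∀ b₁ b₂ : PBond P j,
      |Cloc P j (ρ j / 4) b₁ b₂| ≤ MC * Real.exp (-(δC * (supDist b₁.src b₂.src : ℝ))) := by
    intro j hjk b₁ b₂
    have h := HC P rfl rfl j inferInstance (by omega) (ρ j / 4) b₁ b₂
    rwa [distB_apply] at h
  have hLk : 0 < (P.L : ℝ) ^ k := cast_pow_L_pos' k
  have h := abs_dkLocKer_shift_sub_le hd hk ha hδ hδC hMC.le hH hB hC0 hCζ ρ hρ₀ hρ hCl lam hfar
  rw [neg_mul]
  calc _ ≤ (P.L : ℝ) ^ k * (((P.L : ℝ) ^ k)⁻¹ * ((1 + 16 * C / ρ₀) * (M ^ 2 * MC * ((P.d : ℝ) ^ 2 *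
          (Real.exp (min δ δC / 2 / 2) * ((2 * (1 + P.d / (min δ δC / 2))) ^ P.d) ^ 2))) *
          (((P.d - 1 + 1).factorial : ℝ) / (min δ δC / 2) ^ (P.d - 1 + 1))) *
          Real.exp (-(min δ δC / 2 / 2 * kdist (P := P) k ⟨x, μ⟩ b''))) := mul_le_mul_of_nonneg_left h hLk.le
    _ = _ := by rw [mul_assoc, mul_inv_cancel_left₀ hLk.ne']

/-- **THE DERIVATIVE CLAUSE OF (2.13) ON A TORUS GIVEN ONLY [6I] PROPOSITION 1.2 BY ITS TREE NAME** (per-tower `B5.Prop12Printed` for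
p09's family `levStd` — the `h12` of rows C1.Eq7.2.1-7.2.2 / C2.Eq2.16), radii `ρ_j ≥ ρ₀ > 0`. [cite: BalabanImbrieJaffe1988, (2.13) p.261] -/
theorem gradDkLoc_torus_prop12 (hd : 2 ≤ P.d) {a : ℝ} (ha : 0 < a)
    (h12 : B5.Prop12Printed (fun i => settingOf (torusRep P (levStd P i) (deltaAData (levStd_le i) a)) i))
    {ρ₀ : ℝ} (hρ₀ : 0 < ρ₀) :
    ∃ R₀ c₁ δ' : ℝ, 0 < δ' ∧ 0 ≤ c₁ ∧ ∀ (k : ℕ) (_ : k ≤ P.m + P.K) (ρ : ℕ → ℝ) (_ : ∀ j < k, ρ₀ ≤ ρ j)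
      (x : TSite P 0) (μ lam : Fin P.d) (b'' : PBond P 0), R₀ ≤ kdist (P := P) k ⟨x, μ⟩ b'' →
        (P.L : ℝ) ^ k * |dkLocKer (P := P) ((P.eta k) ^ P.d) ((P.L : ℝ) ^ k) ρ k ⟨x.shift lam, μ⟩ b'' -
            dkLocKer (P := P) ((P.eta k) ^ P.d) ((P.L : ℝ) ^ k) ρ k ⟨x, μ⟩ b''| ≤
          c₁ * Real.exp (-δ' * kdist (P := P) k ⟨x, μ⟩ b'') :=
  gradDkLoc_torus_of_ineq722 hd levStd_le (fun j hj => ⟨j, min_eq_left hj⟩)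
    (ineq722_deltaA_of_prop12Printed (levStd P) levStd_le ha (fun _ => PUnit) (fun _ _ _ => 0) (fun _ _ _ _ _ => 0)
      (fun _ _ _ => 0) h12) ha hρ₀

/-- **THE DERIVATIVE CLAUSE OF (2.13) ON EVERY TORUS, NO HYPOTHESIS** (`d ≥ 2`, radii `ρ_j ≥ ρ₀ > 0`; p16's `prop12Printed_levStd_deltaA`
discharges the per-tower `h12`; constants per torus, typing note G-C1-07). [cite: BalabanImbrieJaffe1988, (2.13) p.261] -/
theorem gradDkLoc_torus (hd : 2 ≤ P.d) {a : ℝ} (ha : 0 < a) {ρ₀ : ℝ} (hρ₀ : 0 < ρ₀) :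
    ∃ R₀ c₁ δ' : ℝ, 0 < δ' ∧ 0 ≤ c₁ ∧ ∀ (k : ℕ) (_ : k ≤ P.m + P.K) (ρ : ℕ → ℝ) (_ : ∀ j < k, ρ₀ ≤ ρ j)
      (x : TSite P 0) (μ lam : Fin P.d) (b'' : PBond P 0), R₀ ≤ kdist (P := P) k ⟨x, μ⟩ b'' →
        (P.L : ℝ) ^ k * |dkLocKer (P := P) ((P.eta k) ^ P.d) ((P.L : ℝ) ^ k) ρ k ⟨x.shift lam, μ⟩ b'' -
            dkLocKer (P := P) ((P.eta k) ^ P.d) ((P.L : ℝ) ^ k) ρ k ⟨x, μ⟩ b''| ≤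
          c₁ * Real.exp (-δ' * kdist (P := P) k ⟨x, μ⟩ b'') :=
  gradDkLoc_torus_prop12 hd ha (prop12Printed_levStd_deltaA P a) hρ₀

end PerTower

/-! ## §3  Over all tori, constants before the torus -/

section AllTori

/-- **THE DERIVATIVE CLAUSE OF (2.13) OVER ALL TORI FROM [6I] PROP. 1.2 BY ITS TREE NAME** (`2 ≤ d`, `L` odd `> 1`, radii `ρ_j ≥ ρ₀ > 0`):
ONE `(R₀, c₁, δ′)`, `δ′ > 0`, `c₁ ≥ 0`, with `L^k·|𝒟_{k,loc}(⟨x+e_λ,μ⟩,b″) − 𝒟_{k,loc}(⟨x,μ⟩,b″)| ≤ c₁e^{−δ′dist_k}` beyond `R₀` on EVERY torus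
(`P.d = d`, `P.L = L`), every `k ≤ m + K`, every schedule with `ρ_j ≥ ρ₀` — §1's explicit bound fed with this seat's
`exists_HB_allTori_of_prop12Printed` (ONE `(δ, M)` for the sup and gradient members on every torus, scale `0` included) and p09's
`(d, L)`-only `cloc_decay`: the constants of Sect. 2 are *"independent of k, T_η"*. [cite: BalabanImbrieJaffe1988, (2.13) p.261] -/
theorem gradDkLoc_allTori_of_prop12Printed {d L : ℕ} (hd : 2 ≤ d) (hL : Odd L ∧ 1 < L) {a : ℝ} (ha : 0 < a)
    (h12 : B5.Prop12Printed (fun i : {x : Params × ℕ // x.1.d = d ∧ x.1.L = L ∧ 1 ≤ x.2 ∧ x.2 ≤ x.1.m + x.1.K} =>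
      settingOf (torusRep i.1.1 i.1.2 (deltaAData i.2.2.2.2 a)) i.1.2))
    {ρ₀ : ℝ} (hρ₀ : 0 < ρ₀) :
    ∃ R₀ c₁ δ' : ℝ, 0 < δ' ∧ 0 ≤ c₁ ∧ ∀ (P : Params) (_ : P.d = d) (_ : P.L = L) (k : ℕ) (_ : k ≤ P.m + P.K) (ρ : ℕ → ℝ)
      (_ : ∀ j < k, ρ₀ ≤ ρ j) (x : TSite P 0) (μ lam : Fin P.d) (b'' : PBond P 0), R₀ ≤ kdist (P := P) k ⟨x, μ⟩ b'' →
        (P.L : ℝ) ^ k * |dkLocKer (P := P) ((P.eta k) ^ P.d) ((P.L : ℝ) ^ k) ρ k ⟨x.shift lam, μ⟩ b'' -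
            dkLocKer (P := P) ((P.eta k) ^ P.d) ((P.L : ℝ) ^ k) ρ k ⟨x, μ⟩ b''| ≤
          c₁ * Real.exp (-δ' * kdist (P := P) k ⟨x, μ⟩ b'') := by
  obtain ⟨δ, M, hδ, -, hHB⟩ := exists_HB_allTori_of_prop12Printed (le_trans one_le_two hd) hL ha h12
  obtain ⟨MC, δC, hMC, hδC, HC⟩ := cloc_decay d L hd
  obtain ⟨C, hC0, hCζ⟩ := exists_cutoffProfile_lipschitz
  refine ⟨2, (1 + 16 * C / ρ₀) * (M ^ 2 * MC * ((d : ℝ) ^ 2 *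
      (Real.exp (min δ δC / 2 / 2) * ((2 * (1 + d / (min δ δC / 2))) ^ d) ^ 2))) *
      (((d - 1 + 1).factorial : ℝ) / (min δ δC / 2) ^ (d - 1 + 1)),
    min δ δC / 2 / 2, ?_, ?_, fun P hPd hPL k hk ρ hρ x μ lam b'' hfar => ?_⟩
  · have := lt_min hδ hδC; positivity
  · have := lt_min hδ hδC; positivity
  have hH : ∀ (j : ℕ) (hj : j ≤ P.m + P.K), j < k → ∀ (μ ν : Fin P.d) (x'' : TSite P 0) (y : TSite P j),
      |(torusRep P j (deltaAData hj a)).H (x'', μ) (y, ν)| ≤ M * Real.exp (-(δ * distEU P j x'' y)) :=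
    fun j hj _ μ ν x'' y => (hHB P hPd hPL j hj μ ν x'' y).1
  have hB : ∀ (j : ℕ) (hj : j ≤ P.m + P.K), j < k → ∀ (μ ν : Fin P.d) (x : TSite P 0) (y : TSite P j),
      ‖fun lam : Fin P.d => (P.L : ℝ) ^ j *
          ((torusRep P j (deltaAData hj a)).H (x.shift lam, μ) (y, ν) - (torusRep P j (deltaAData hj a)).H (x, μ) (y, ν))‖ ≤
        M * Real.exp (-(δ * distEU P j x y)) :=
    fun j hj _ μ ν x y => (hHB P hPd hPL j hj μ ν x y).2
  have hCl : ∀ j < k, ∀ b₁ b₂ : PBond P j,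
      |Cloc P j (ρ j / 4) b₁ b₂| ≤ MC * Real.exp (-(δC * (supDist b₁.src b₂.src : ℝ))) := by
    intro j hjk b₁ b₂
    have h := HC P hPd hPL j inferInstance (by omega) (ρ j / 4) b₁ b₂
    rwa [distB_apply] at h
  subst hPd
  have hLk : 0 < (P.L : ℝ) ^ k := pow_pos P.cast_L_pos k
  have h := abs_dkLocKer_shift_sub_le hd hk ha hδ hδC hMC.le hH hB hC0 hCζ ρ hρ₀ hρ hCl lam hfar
  rw [neg_mul]
  calc _ ≤ (P.L : ℝ) ^ k * (((P.L : ℝ) ^ k)⁻¹ * ((1 + 16 * C / ρ₀) * (M ^ 2 * MC * ((P.d : ℝ) ^ 2 *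
          (Real.exp (min δ δC / 2 / 2) * ((2 * (1 + P.d / (min δ δC / 2))) ^ P.d) ^ 2))) *
          (((P.d - 1 + 1).factorial : ℝ) / (min δ δC / 2) ^ (P.d - 1 + 1))) *
          Real.exp (-(min δ δC / 2 / 2 * kdist (P := P) k ⟨x, μ⟩ b''))) := mul_le_mul_of_nonneg_left h hLk.le
    _ = _ := by rw [mul_assoc, mul_inv_cancel_left₀ hLk.ne']

end AllTori

end

end Literature.MathematicalPhysics.QuantumFieldTheory.BalabanImbrieJaffe1984to88.BIJ88CurlyDkLocGradTorus
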